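import Summits.HubbardSuperconductivity.HubbardSuperconductivity.Theorems.SoloBlindCertificateFromGap
import Summits.HubbardSuperconductivity.HubbardSuperconductivity.Theorems.SoloBlindCertificateForm
import Mathlib.Analysis.InnerProductSpace.Projection.Basic
import HarnessLib

/-!
# The certificate multiplier from the gap above the ground eigenspace (self-contained form)

`certificate_multiplier_of_sectorGap` (`SoloBlindCertificateFromGap`) was stated for an abstract
matrix `P` with three properties. Here the projection is CONSTRUCTED (Mathlib's orthogonal projection
`Submodule.starProjection` onto the `E₀`-eigenvectors of `H` inside the sector, transported along
`WithLp.toLp 2 : (n → ℂ) → EuclideanSpace ℂ n`), so that the only inputs left are the two spectral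
hypotheses a proof of the summit would actually have to establish on each large even torus:

* ORDER ON THE GROUND EIGENSPACE: `a ‖ψ‖² ≤ re ⟨Δ_g ψ, Δ_g ψ⟩` for every `ψ` in the sector `S` with
  `H ψ = E₀ ψ` (for `E₀` the sector ground energy this is requirement R1 with `a = c L⁴`);
* A VARIATIONAL GAP `γ > 0` ABOVE IT: `γ ‖w‖² ≤ re ⟨w, H w⟩ - E₀ ‖w‖²` for every `w ∈ S` orthogonal to
  all such `ψ` (the best constant is the gap `E₁(S) - E₀(S)` to the next eigenvalue of `H` in the
  sector, positive by finite-dimensionality).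

Conclusion (`certificate_multiplier_of_groundGap`): every `φ ∈ S` satisfies
`(a/2) ‖φ‖² ≤ re ⟨Δ_g φ, Δ_g φ⟩ + ((400 L⁴ + a/2)/γ) (re ⟨φ, H φ⟩ - E₀ ‖φ‖²)` — the certificate of
`hubbardSuperconductivity_iff_certificate` with the explicit multiplier `κ = (400 L⁴ + a/2)/γ`.
Ingredients: `energy_above_eigen_add_orthogonal` (the energy of `u + w` above `E₀` equals that of
`w` when `H u = E₀ u`, `u ⊥ w`, `H` Hermitian) and the abstract `certificate_of_orthogonal_split`.

References: finite-dimensional spectral theory (Reed–Simon IV §XIII.1); Mathlib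
`Submodule.starProjection`, `Submodule.sub_starProjection_mem_orthogonal`.
-/

namespace Summit.HubbardSuperconductivity.HubbardSuperconductivity.Theorems

open Matrix Finset Literature.MathematicalPhysics.QuantumLattice
  Literature.MathematicalPhysics.QuantumFieldTheory GaugeTwist WithLp
open scoped ComplexConjugate ComplexOrder InnerProductSpace

section Abstract

variable {n : Type*} [Fintype n]

/-- `⟨w, u⟩ = 0` from `⟨u, w⟩ = 0`. [folklore] -/
theorem star_dotProduct_eq_zero_symm {u w : n → ℂ} (h : star u ⬝ᵥ w = 0) : star w ⬝ᵥ u = 0 := by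
  have h' : star w ⬝ᵥ u = star (star u ⬝ᵥ w) := by
    rw [← star_dotProduct_star, star_star]
  rw [h', h, star_zero]

/-- **Energy above an eigenvalue splits off the eigen-component**: if `H` is Hermitian,
`H u = E₀ u` and `⟨u, w⟩ = 0`, then
`⟨u+w, H(u+w)⟩ - E₀ ‖u+w‖² = ⟨w, H w⟩ - E₀ ‖w‖²`. [folklore] -/
theorem energy_above_eigen_add_orthogonal {H : Matrix n n ℂ} (hH : H.IsHermitian) (u w : n → ℂ)
    (E₀ : ℝ) (hu : H *ᵥ u = (E₀ : ℂ) • u) (horth : star u ⬝ᵥ w = 0) :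
    star (u + w) ⬝ᵥ (H *ᵥ (u + w)) - (E₀ : ℂ) * (star (u + w) ⬝ᵥ (u + w)) =
      star w ⬝ᵥ (H *ᵥ w) - (E₀ : ℂ) * (star w ⬝ᵥ w) := by
  have h1 : star u ⬝ᵥ (H *ᵥ w) = 0 := by
    rw [dotProduct_mulVec, ← hH.eq, ← star_mulVec, hu, star_smul, smul_dotProduct, horth,
      smul_zero]
  have h2 : star w ⬝ᵥ u = 0 := star_dotProduct_eq_zero_symm horth
  rw [mulVec_add, hu, star_add, add_dotProduct, add_dotProduct, dotProduct_add, dotProduct_add,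
    dotProduct_add, dotProduct_add, dotProduct_smul, dotProduct_smul, h1, h2, horth]
  simp only [smul_eq_mul, mul_zero, add_zero, zero_add]
  ring

/-- Real parts of the previous identity. [folklore] -/
theorem re_energy_above_eigen_add_orthogonal {H : Matrix n n ℂ} (hH : H.IsHermitian)
    (u w : n → ℂ) (E₀ : ℝ) (hu : H *ᵥ u = (E₀ : ℂ) • u) (horth : star u ⬝ᵥ w = 0) :
    (star (u + w) ⬝ᵥ (H *ᵥ (u + w))).re - E₀ * (star (u + w) ⬝ᵥ (u + w)).re =
      (star w ⬝ᵥ (H *ᵥ w)).re - E₀ * (star w ⬝ᵥ w).re := by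
  have h := congrArg Complex.re (energy_above_eigen_add_orthogonal hH u w E₀ hu horth)
  simpa only [Complex.sub_re, Complex.re_ofReal_mul] using h

/-- **Orthogonal splitting along the ground eigenspace** (finite-dimensional spectral theorem, the
part that is needed): every `φ ∈ S` is `u + w` with `u ∈ S`, `H u = E₀ u`, `w ∈ S`, and `w`
orthogonal to every `E₀`-eigenvector of `H` in `S` (in particular to `u`). [folklore] -/
theorem exists_eigen_add_orthogonal (H : Matrix n n ℂ) (S : Submodule ℂ (n → ℂ)) (E₀ : ℝ)
    {φ : n → ℂ} (hφ : φ ∈ S) :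
    ∃ u w : n → ℂ, φ = u + w ∧ u ∈ S ∧ H *ᵥ u = (E₀ : ℂ) • u ∧ w ∈ S ∧
      ∀ ψ ∈ S, H *ᵥ ψ = (E₀ : ℂ) • ψ → star ψ ⬝ᵥ w = 0 := by
  -- the `E₀`-eigenvectors of `H` inside `S`, transported to `EuclideanSpace ℂ n`
  let K : Submodule ℂ (EuclideanSpace ℂ n) :=
    { carrier := {x | ofLp x ∈ S ∧ H *ᵥ ofLp x = (E₀ : ℂ) • ofLp x}
      zero_mem' := by simp
      add_mem' := by
        rintro x y ⟨hxS, hx⟩ ⟨hyS, hy⟩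
        refine ⟨?_, ?_⟩
        · rw [ofLp_add]; exact S.add_mem hxS hyS
        · rw [ofLp_add, mulVec_add, hx, hy, smul_add]
      smul_mem' := by
        rintro c x ⟨hxS, hx⟩
        refine ⟨?_, ?_⟩
        · rw [ofLp_smul]; exact S.smul_mem c hxS
        · rw [ofLp_smul, mulVec_smul, hx, smul_comm] }
  have hmem : ∀ y : EuclideanSpace ℂ n, y ∈ K ↔ ofLp y ∈ S ∧ H *ᵥ ofLp y = (E₀ : ℂ) • ofLp y :=
    fun _ => Iff.rfl
  set x : EuclideanSpace ℂ n := toLp 2 φ with hx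
  have huK : K.starProjection x ∈ K := K.starProjection_apply_mem x
  have hwK : x - K.starProjection x ∈ Kᗮ := K.sub_starProjection_mem_orthogonal x
  rw [hmem] at huK
  refine ⟨ofLp (K.starProjection x), ofLp (x - K.starProjection x), ?_, huK.1, huK.2, ?_, ?_⟩
  · rw [← ofLp_add, add_sub_cancel, hx, ofLp_toLp]
  · have : ofLp (x - K.starProjection x) = φ - ofLp (K.starProjection x) := by
      rw [ofLp_sub, hx, ofLp_toLp]
    rw [this]
    exact S.sub_mem hφ huK.1
  · intro ψ hψS hψ
    have hψK : (toLp 2 ψ : EuclideanSpace ℂ n) ∈ K := by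
      rw [hmem, ofLp_toLp]; exact ⟨hψS, hψ⟩
    have h0 := (Submodule.mem_orthogonal K _).1 hwK _ hψK
    rw [EuclideanSpace.inner_eq_star_dotProduct, dotProduct_comm, ofLp_toLp] at h0
    exact h0

end Abstract

section Hubbard

variable {L : ℕ} [NeZero L]

/-- **Explicit certificate multiplier from the gap above the ground eigenspace** (self-contained
form of `certificate_multiplier_of_sectorGap`): Hubbard torus with any `t, U`; any subspace `S` of
Fock space; form factor `|g| ≤ 1`; reference energy `E₀`; order `a ≥ 0` on the `E₀`-eigenvectors of
`H` in `S`; variational gap `γ > 0` on their orthogonal complement in `S`. Then every `φ ∈ S` obeys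
the certificate with multiplier `(400 L⁴ + a/2)/γ`. [this work] -/
theorem certificate_multiplier_of_groundGap (t U E₀ a γ : ℝ) (hγ : 0 < γ) (ha : 0 ≤ a)
    (g : (Fin 2 → ℤ) → ℝ) (hg : ∀ e, |g e| ≤ 1)
    (S : Submodule ℂ (Fock (Orb (FermionTorus 2 L))))
    (hord : ∀ ψ ∈ S, hubbardTorus 2 L t U *ᵥ ψ = (E₀ : ℂ) • ψ →
      a * (star ψ ⬝ᵥ ψ).re ≤ (star (pairField g L *ᵥ ψ) ⬝ᵥ (pairField g L *ᵥ ψ)).re)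
    (hgap : ∀ w ∈ S, (∀ ψ ∈ S, hubbardTorus 2 L t U *ᵥ ψ = (E₀ : ℂ) • ψ → star ψ ⬝ᵥ w = 0) →
      γ * (star w ⬝ᵥ w).re ≤
        (star w ⬝ᵥ (hubbardTorus 2 L t U *ᵥ w)).re - E₀ * (star w ⬝ᵥ w).re) :
    ∀ φ ∈ S, a / 2 * (star φ ⬝ᵥ φ).re ≤
      (star (pairField g L *ᵥ φ) ⬝ᵥ (pairField g L *ᵥ φ)).re +
        (400 * (L : ℝ) ^ 4 + a / 2) / γ *
          ((star φ ⬝ᵥ (hubbardTorus 2 L t U *ᵥ φ)).re - E₀ * (star φ ⬝ᵥ φ).re) := by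
  intro φ hφ
  obtain ⟨u, w, rfl, huS, hu, hwS, hw⟩ :=
    exists_eigen_add_orthogonal (hubbardTorus 2 L t U) S E₀ hφ
  have horth : star u ⬝ᵥ w = 0 := hw u huS hu
  have hre : (star u ⬝ᵥ w).re = 0 := by rw [horth, Complex.zero_re]
  have hH : (hubbardTorus 2 L t U).IsHermitian := isHermitian_hubbardTorus L t U
  rw [re_energy_above_eigen_add_orthogonal hH u w E₀ hu horth]
  exact certificate_of_orthogonal_split (pairField g L) u w a (400 * (L : ℝ) ^ 4) γ _ hγ
    (by positivity) hre (hord u huS hu) (pairField_order_le g hg w) (hgap w hwS hw)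

end Hubbard

end Summit.HubbardSuperconductivity.HubbardSuperconductivity.Theorems
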